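import Mathlib.Tactic.ComputeDegree
import Literature.NumberTheory.EllipticCurves.IsogenyFormulaCert
import Literature.NumberTheory.EllipticCurves.IsogenyFormulaDegree
import Literature.NumberTheory.EllipticCurves.IsogenyDualProofs
import Literature.NumberTheory.EllipticCurves.MazurTorsionGaloisStructureProofs
import Literature.NumberTheory.EllipticCurves.SelmerCorankProofs
import Literature.NumberTheory.EllipticCurves.X1ElevenKummerValues
import HarnessLib

/-!
# The `5`-descent on `X₁(11)`, II: the explicit `5`-isogeny `φ : 11A3 → 11A1` with kernel
# `⟨(0,0)⟩ ≅ ℤ/5`, and the `Γ_ℚ`-stable coset above the rational `5`-torsion of `11A1`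

Second file of the explicit rendering of Mazur's Eisenstein descent for `N = 11` (B. Mazur,
*Modular curves and the Eisenstein ideal*, Publ. Math. IHÉS 47 (1977), Ch. III §3, Thm. (3.1);
see `X1ElevenKummerValues` for the overview). Here the isogeny `J₁(11) → J₀(11)` dual to the one
with kernel the Shimura subgroup — on Cremona's minimal models

  `11A3 = X₁(11) : y² + y = x³ - x²`,   `11A1 = X₀(11) : y² + y = x³ - x² - 10x - 20`  —

is produced as a genuine term of the tree's `WeierstrassCurve.Isogeny` (a `Γ_ℚ`-equivariant,
algebraic homomorphism on `ℚ̄`-points) from **Vélu's formulae** (J. Vélu, *Isogénies entre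
courbes elliptiques*, C. R. Acad. Sci. Paris 273 (1971), 238–241, whose worked example is
precisely `X₀(11)`) through the tree's `IsogenyFormula`/`IsogenyCert` machine
(`IsogenyFromRationalMap`, Silverman *AEC* Thm. III.4.8 **proved**; `IsogenyFormulaCert`,
kernel-checked certificates): with kernel polynomial `h = x² - x` (the `x`-coordinates `0, 1` of
`⟨T⟩ ∖ O`, `T = (0,0)`),

  `φ(x, y) = ( U(x)/h(x)², (S(x)·y + T(x))/h(x)³ )`,
  `U = x⁵ - 2x⁴ + 3x³ - 2x + 1`, `S = x⁶ - 3x⁵ + x⁴ - 3x³ + 6x² - 6x + 2`,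
  `T = -x⁴ - x³ + 3x² - 3x + 1`

(computed with PARI/GP `ellisogeny(ellinit([0,-1,1,0,0]), x^2-x)`, which lands directly on the
minimal model `[0,-1,1,-10,-20]`; the two identities of `IsogenyFormula` are certified by
`decide +kernel` on integer coefficient lists, `fiveIsogenyCert_check`).

## Main results (all proved)

* `curve11A1` (Cremona's `11A1`), ellipticity instances for `11A3`, `11A1`
  (`Δ = -11`, `-11⁵`).
* `fiveIsogenyCert`, `fiveIsogenyFormula : IsogenyFormula curve11A3 curve11A1`,
  **`fiveIsogeny : Isogeny curve11A3 curve11A1`**; the explicit polynomials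
  (`fiveIsogenyFormula_U/_h/_S/_T`) and `fiveIsogeny_some` (the value at a geometric point with
  `x ≠ 0, 1`).
* **`ker_fiveIsogeny : ker φ = ⟨T̄⟩`** (`T̄` the geometric point of `T = (0,0)`): `⊇` because
  `#ker φ = deg U = 5` (tree `IsogenyFormula.degree_toIsogeny`, `U ≡ 1 mod h`) while the kernel
  lies in the five-element set `{O} ∪ {h(x) = 0} = {O, (0,0), (0,-1), (1,0), (1,-1)}`
  (off `h = 0` the isogeny is the formula, whose value is an affine point); in particular
  `addOrderOf T̄ = addOrderOf T = 5` with no chord–tangent computation on `11A3`.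
* `fiveIsogeny_surjective` (tree: isogenies are onto `ℚ̄`-points, *AEC* II.2.3).
* `T' = (5,5) ∈ 11A1(ℚ)` has order `5` (`five_nsmul_T'`: `2T' = (16,-61)`, `4T' = (5,-6) = -T'`).
* **`exists_stableCoset_over_T'`**: there is `Q₀ ∈ 11A3(ℚ̄)` with `φ Q₀ = T̄'`,
  `σ Q₀ - Q₀ ∈ ⟨T̄⟩` for all `σ ∈ Γ_ℚ` (the coset `Q₀ + ⟨T⟩` is `Γ_ℚ`-stable: it is the fibre of
  `φ` over a rational point), `5 Q₀ ∈ ⟨T̄⟩`, and **`5 Q₀ ≠ O`** — the last because otherwise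
  `Q₀ ∈ E[5] ∖ ⟨T̄⟩` would span with `T̄` a frame in which `ρ̄_{E,5}` is unipotent, contradicting
  `det ρ̄_{E,5} = χ̄₅ ≠ 1` (tree: Mazur's (5.4) `smul_sub_cyclotomic_smul_mem_zmultiples`, proved
  Weil pairing; `exists_modPCyclotomicCharacterZMod_five_ne_one`, `χ̄₅ ≠ 1` on `Γ_ℚ`). Hence `Q₀` has order `25` and
  `⟨Q₀⟩ ⊇ ⟨T⟩`; in Mazur's terms, `T' ∈ 11A1(ℚ)` does not lie in the Shimura subgroup
  `Σ = φ(E[5]) ≅ μ₅`.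
* `node_congr_X/_Y/_h` (polynomial identities): `U - 5h² ∈ (x - 8, 11)`,
  `5S + T - 5h³ ∈ (x - 8, 11)`, `h - 1 ∈ (x - 8, 11)` — the formula maps the node `(8, 5)` of
  `11A3 mod 11` to the node `(5, 5)` of `11A1 mod 11` (used by the ramification analysis at `11`
  of the constant-kernel side of the descent, file IV).

## References

* [Mazur1977] B. Mazur, *Modular curves and the Eisenstein ideal*, Publ. Math. IHÉS 47 (1977):
  Ch. II §11 (Shimura subgroup), Ch. III §3 Thm. (3.1), Ch. III §5 p. 157 ((5.4)).
* [Velu1971] J. Vélu, *Isogénies entre courbes elliptiques*, C. R. Acad. Sci. Paris Sér. A 273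
  (1971), 238–241 (the formulae; example `X₀(11)`).
* [SilvermanAEC2009] J. H. Silverman, *The Arithmetic of Elliptic Curves*, 2nd ed. (2009):
  Thm. III.4.8, Rem. III.4.13.3, Thm. III.4.10(c), Thm. II.2.3, Prop. III.8.1.
* [CremonaAlgorithms1997] J. E. Cremona, *Algorithms for Modular Elliptic Curves*, 2nd ed.
  (1997), Table 1, `N = 11` (`A1 = [0,-1,1,-10,-20]`, `A3 = [0,-1,1,0,0]`, isogeny degrees `5`).

## Design

Theorems, instances and definitions with bodies only (no named facts). `ℚ̄ = AlgebraicClosure ℚ`,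
`geomPoints`, `toGeomPoints`, `Isogeny` are the tree's; decidability of the group law is the
classical one (`open scoped Classical`, as in the prelude files). The rational points `T`, `T'`
are built from `Affine.Point.some` with `norm_num` nonsingularity proofs.
-/

noncomputable section

open scoped Classical
open Polynomial WeierstrassCurve

namespace Literature.NumberTheory.EllipticCurves.X1Eleven

open Literature.NumberTheory.EllipticCurves.PolyCert

/-- `5` is prime (instance form, for the mod-`5` Galois representation files). [folklore] -/
instance factPrimeFive : Fact (Nat.Prime 5) := ⟨Nat.prime_five⟩


/-! ### The curves `11A3`, `11A1` and their ellipticity -/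

/-- Cremona's curve `11A1 = [0, -1, 1, -10, -20] : y² + y = x³ - x² - 10x - 20`, the modular
curve `X₀(11)` (minimal model, `Δ = -11⁵`), Mazur's `J = J̃` for `N = 11`.
[cite: CremonaAlgorithms1997, Table 1, N = 11, curve A1] -/
def curve11A1 : WeierstrassCurve ℚ := ⟨0, -1, 1, -10, -20⟩

/-- Unfolding the coefficients of `11A1`. [folklore] -/
@[simp] theorem curve11A1_a₁ : curve11A1.a₁ = 0 := rfl
/-- Unfolding the coefficients of `11A1`. [folklore] -/
@[simp] theorem curve11A1_a₂ : curve11A1.a₂ = -1 := rfl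
/-- Unfolding the coefficients of `11A1`. [folklore] -/
@[simp] theorem curve11A1_a₃ : curve11A1.a₃ = 1 := rfl
/-- Unfolding the coefficients of `11A1`. [folklore] -/
@[simp] theorem curve11A1_a₄ : curve11A1.a₄ = -10 := rfl
/-- Unfolding the coefficients of `11A1`. [folklore] -/
@[simp] theorem curve11A1_a₆ : curve11A1.a₆ = -20 := rfl

/-- `Δ(11A3) = -11`. [cite: CremonaAlgorithms1997, Table 1, N = 11, curve A3] -/
theorem curve11A3_Δ : curve11A3.Δ = -11 := by
  norm_num [curve11A3, WeierstrassCurve.Δ, WeierstrassCurve.b₂, WeierstrassCurve.b₄,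
    WeierstrassCurve.b₆, WeierstrassCurve.b₈]

/-- `Δ(11A1) = -11⁵`. [cite: CremonaAlgorithms1997, Table 1, N = 11, curve A1] -/
theorem curve11A1_Δ : curve11A1.Δ = -11 ^ 5 := by
  norm_num [curve11A1, WeierstrassCurve.Δ, WeierstrassCurve.b₂, WeierstrassCurve.b₄,
    WeierstrassCurve.b₆, WeierstrassCurve.b₈]

/-- `11A3` is an elliptic curve. [cite: CremonaAlgorithms1997, Table 1, N = 11, curve A3] -/
instance instIsEllipticCurve11A3 : curve11A3.IsElliptic :=
  ⟨by rw [curve11A3_Δ]; exact isUnit_iff_ne_zero.mpr (by norm_num)⟩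

/-- `11A1` is an elliptic curve. [cite: CremonaAlgorithms1997, Table 1, N = 11, curve A1] -/
instance instIsEllipticCurve11A1 : curve11A1.IsElliptic :=
  ⟨by rw [curve11A1_Δ]; exact isUnit_iff_ne_zero.mpr (by norm_num)⟩

/-- The affine equation of `11A1` is `y² + y = x³ - x² - 10x - 20`. [folklore] -/
theorem curve11A1_equation_iff (x y : ℚ) :
    curve11A1.toAffine.Equation x y ↔ y ^ 2 + y = x ^ 3 - x ^ 2 - 10 * x - 20 := by
  rw [WeierstrassCurve.Affine.equation_iff]
  simp only [curve11A1_a₁, curve11A1_a₂, curve11A1_a₃, curve11A1_a₄, curve11A1_a₆]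
  constructor <;> intro h <;> linear_combination h

/-! ### Vélu's `5`-isogeny as a kernel-checked certificate -/

/-- **The certificate of the `5`-isogeny `11A3 → 11A1`** (Vélu's formulae for the kernel
`⟨(0,0)⟩`, kernel polynomial `x² - x`; PARI/GP `ellisogeny`): `U = x⁵ - 2x⁴ + 3x³ - 2x + 1`,
`h = x² - x`, `S = x⁶ - 3x⁵ + x⁴ - 3x³ + 6x² - 6x + 2`, `T = -x⁴ - x³ + 3x² - 3x + 1`
(coefficient lists, constant term first). [cite: Velu1971, formulae (the example X₀(11)); SilvermanAEC2009, Rem. III.4.13.3] -/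
def fiveIsogenyCert : IsogenyCert where
  a₁ := 0
  a₂ := -1
  a₃ := 1
  a₄ := 0
  a₆ := 0
  a₁' := 0
  a₂' := -1
  a₃' := 1
  a₄' := -10
  a₆' := -20
  U := [1, -2, 0, 3, -2, 1]
  h := [0, -1, 1]
  S := [2, -6, 6, -3, 1, -3, 1]
  T := [1, -3, 3, -1, -1]

/-- The certificate checks (both identities of `IsogenyFormula`, `deg h² < deg U`, by the kernel).
[cite: SilvermanAEC2009, Thm. III.4.8 and Rem. III.4.13.3] -/
theorem fiveIsogenyCert_check : fiveIsogenyCert.check = true := by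
  decide +kernel

/-- **Vélu's isogeny formula `11A3 → 11A1`** as an `IsogenyFormula`. [cite: Velu1971, formulae; SilvermanAEC2009, Thm. III.4.8] -/
def fiveIsogenyFormula : IsogenyFormula curve11A3 curve11A1 :=
  fiveIsogenyCert.toFormula fiveIsogenyCert_check _ _
    (by simp [curve11A3, fiveIsogenyCert]) (by simp [curve11A1, fiveIsogenyCert])

/-- `U = x⁵ - 2x⁴ + 3x³ - 2x + 1`. [cite: Velu1971, formulae] -/
theorem fiveIsogenyFormula_U :
    fiveIsogenyFormula.U = X ^ 5 - 2 * X ^ 4 + 3 * X ^ 3 - 2 * X + 1 := by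
  show (ofList fiveIsogenyCert.U : ℚ[X]) = _
  simp only [fiveIsogenyCert, ofList_cons, ofList_nil, Int.cast_one, Int.cast_neg, Int.cast_zero,
    Int.cast_ofNat, map_one, map_neg, map_zero, map_ofNat]
  ring

/-- `h = x² - x`. [cite: Velu1971, formulae] -/
theorem fiveIsogenyFormula_h : fiveIsogenyFormula.h = X ^ 2 - X := by
  show (ofList fiveIsogenyCert.h : ℚ[X]) = _
  simp only [fiveIsogenyCert, ofList_cons, ofList_nil, Int.cast_one, Int.cast_neg, Int.cast_zero,
    map_one, map_neg, map_zero]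
  ring

/-- `S = x⁶ - 3x⁵ + x⁴ - 3x³ + 6x² - 6x + 2`. [cite: Velu1971, formulae] -/
theorem fiveIsogenyFormula_S :
    fiveIsogenyFormula.S = X ^ 6 - 3 * X ^ 5 + X ^ 4 - 3 * X ^ 3 + 6 * X ^ 2 - 6 * X + 2 := by
  show (ofList fiveIsogenyCert.S : ℚ[X]) = _
  simp only [fiveIsogenyCert, ofList_cons, ofList_nil, Int.cast_one, Int.cast_neg,
    Int.cast_ofNat, map_one, map_neg, map_ofNat]
  ring

/-- `T = -x⁴ - x³ + 3x² - 3x + 1`. [cite: Velu1971, formulae] -/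
theorem fiveIsogenyFormula_T :
    fiveIsogenyFormula.T = -X ^ 4 - X ^ 3 + 3 * X ^ 2 - 3 * X + 1 := by
  show (ofList fiveIsogenyCert.T : ℚ[X]) = _
  simp only [fiveIsogenyCert, ofList_cons, ofList_nil, Int.cast_one, Int.cast_neg,
    Int.cast_ofNat, map_one, map_neg, map_ofNat]
  ring

/-- `deg U = 5`. [folklore] -/
theorem natDegree_fiveIsogenyFormula_U : fiveIsogenyFormula.U.natDegree = 5 := by
  rw [fiveIsogenyFormula_U]; compute_degree!

/-- `U ≡ 1 (mod h)`: `U = 1 + h·(x³ - x² + 2x + 2)`, so `U` and `h` are coprime. [folklore] -/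
theorem isCoprime_fiveIsogenyFormula_U_h : IsCoprime fiveIsogenyFormula.U fiveIsogenyFormula.h := by
  refine ⟨1, -(X ^ 3 - X ^ 2 + 2 * X + 2), ?_⟩
  rw [fiveIsogenyFormula_U, fiveIsogenyFormula_h]
  ring

/-! ### The isogeny `φ : 11A3 → 11A1` -/

/-- **The `5`-isogeny `φ : 11A3 → 11A1`** (`X₁(11) → X₀(11)`), a term of the tree's `Isogeny`:
the homomorphism on `ℚ̄`-points attached to Vélu's formula by `IsogenyFormula.toIsogeny`
(Silverman, *AEC*, Thm. III.4.8). [cite: Velu1971, formulae (example X₀(11)); SilvermanAEC2009, Thm. III.4.8] -/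
def fiveIsogeny : Isogeny curve11A3 curve11A1 :=
  fiveIsogenyFormula.toIsogeny

/-- Evaluation of `h` over `ℚ̄`: `h(x) = x² - x`. [folklore] -/
theorem eval_geom_h (x : AlgebraicClosure ℚ) : fiveIsogenyFormula.geom.h.eval x = x ^ 2 - x := by
  show (fiveIsogenyFormula.h.map (algebraMap ℚ (AlgebraicClosure ℚ))).eval x = _
  rw [fiveIsogenyFormula_h]
  simp

/-- **`φ` on a geometric affine point `(x, y)` with `x ≠ 0, 1` is Vélu's formula**
`(U(x)/h(x)², (S(x) y + T(x))/h(x)³)`. [cite: Velu1971, formulae; SilvermanAEC2009, Thm. III.4.8] -/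
theorem fiveIsogeny_some {x y : AlgebraicClosure ℚ}
    (hxy : (curve11A3.baseChange (AlgebraicClosure ℚ)).toAffine.Nonsingular x y)
    (hx : x ^ 2 - x ≠ 0) :
    ∃ h', fiveIsogeny (Affine.Point.some x y hxy) =
      Affine.Point.some (fiveIsogenyFormula.geom.valX x) (fiveIsogenyFormula.geom.valY x y) h' :=
  ⟨_, fiveIsogenyFormula.toIsogeny_some hxy (by rwa [eval_geom_h])⟩

/-- Off `h = 0` the value of `φ` is an affine point, in particular non-zero. [folklore] -/
theorem fiveIsogeny_some_ne_zero {x y : AlgebraicClosure ℚ}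
    (hxy : (curve11A3.baseChange (AlgebraicClosure ℚ)).toAffine.Nonsingular x y)
    (hx : x ^ 2 - x ≠ 0) : fiveIsogeny (Affine.Point.some x y hxy) ≠ 0 := by
  obtain ⟨h', e⟩ := fiveIsogeny_some hxy hx
  rw [e]
  exact Affine.Point.some_ne_zero h'

/-! ### The rational `5`-torsion point `T = (0,0)` of `11A3` and the kernel of `φ` -/

/-- `Δ(11A3/ℚ̄) ≠ 0`. [folklore] -/
theorem geom_curve11A3_Δ_ne_zero : (curve11A3.baseChange (AlgebraicClosure ℚ)).Δ ≠ 0 := by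
  rw [WeierstrassCurve.baseChange, map_Δ, curve11A3_Δ]; norm_num

/-- The nonsingular `ℚ̄`-points of `11A3` are the solutions of `y² + y = x³ - x²`. [folklore] -/
theorem nonsingular_geom_curve11A3_iff (x y : AlgebraicClosure ℚ) :
    (curve11A3.baseChange (AlgebraicClosure ℚ)).toAffine.Nonsingular x y ↔
      y ^ 2 + y = x ^ 3 - x ^ 2 := by
  rw [← Affine.equation_iff_nonsingular_of_Δ_ne_zero geom_curve11A3_Δ_ne_zero, Affine.equation_iff]
  simp only [WeierstrassCurve.baseChange, map_a₁, map_a₂, map_a₃, map_a₄, map_a₆, curve11A3_a₁,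
    curve11A3_a₂, curve11A3_a₃, curve11A3_a₄, curve11A3_a₆, map_zero, map_one, map_neg]
  constructor <;> intro h <;> linear_combination h

/-- `T = (0, 0) ∈ 11A3(ℚ)`. [cite: CremonaAlgorithms1997, Table 1, N = 11, curve A3 (|T| = 5)] -/
def T : curve11A3.toAffine.Point :=
  Affine.Point.some 0 0 (by
    refine (Affine.nonsingular_iff' _ _).mpr ⟨?_, Or.inr ?_⟩ <;> norm_num [curve11A3])

/-- The geometric point `T̄ = (0, 0) ∈ 11A3(ℚ̄)`. [folklore] -/
def Tbar : geomPoints curve11A3 :=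
  Affine.Point.some 0 0 ((nonsingular_geom_curve11A3_iff 0 0).mpr (by norm_num))

/-- Two affine points with equal coordinates are equal (proof-irrelevant form). [folklore] -/
theorem some_eq_some_of_eq {R : Type*} [CommRing R] {V : WeierstrassCurve R} {x y x' y' : R}
    (hx : x = x') (hy : y = y') (h : V.toAffine.Nonsingular x y)
    (h' : V.toAffine.Nonsingular x' y') : Affine.Point.some x y h = Affine.Point.some x' y' h' := by
  subst hx hy; rfl

/-- `T̄` is the image of `T` under `11A3(ℚ) → 11A3(ℚ̄)`. [folklore] -/
theorem toGeomPoints_T : toGeomPoints curve11A3 T = Tbar := by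
  simp only [toGeomPoints, T, Tbar, Affine.Point.baseChange]
  exact some_eq_some_of_eq (map_zero _) (map_zero _) _ _

/-- `T̄ ≠ O`. [folklore] -/
theorem Tbar_ne_zero : Tbar ≠ 0 :=
  Affine.Point.some_ne_zero _

/-- `T̄` is `Γ_ℚ`-fixed (it is rational). [folklore] -/
theorem smul_Tbar (σ : Field.absoluteGaloisGroup ℚ) : σ • Tbar = Tbar := by
  rw [← toGeomPoints_T]; exact smul_toGeomPoints curve11A3 σ T

/-- **The kernel of `φ` lies in `{O, (0,0), (0,-1), (1,0), (1,-1)}`**: an affine geometric point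
in `ker φ` has `h(x) = x² - x = 0` (elsewhere `φ` is the formula, with affine value), hence
`x ∈ {0, 1}` and `y² + y = x³ - x² = 0`, `y ∈ {0, -1}`. [folklore] -/
theorem mem_ker_fiveIsogeny_imp {P : geomPoints curve11A3} (hP : fiveIsogeny P = 0) :
    P = 0 ∨ ∃ (x y : AlgebraicClosure ℚ) (h : _), P = Affine.Point.some x y h ∧
      (x = 0 ∨ x = 1) ∧ (y = 0 ∨ y = -1) := by
  rcases P with _ | ⟨x, y, hxy⟩
  · exact Or.inl rfl
  right
  refine ⟨x, y, hxy, rfl, ?_⟩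
  have hx : x ^ 2 - x = 0 := by
    by_contra hx
    exact fiveIsogeny_some_ne_zero hxy hx hP
  have hx' : x = 0 ∨ x = 1 := by
    have : x * (x - 1) = 0 := by linear_combination hx
    rcases mul_eq_zero.mp this with h0 | h1
    · exact Or.inl h0
    · exact Or.inr (by linear_combination h1)
  have heq : y ^ 2 + y = x ^ 3 - x ^ 2 := (nonsingular_geom_curve11A3_iff x y).mp hxy
  have hy : y * (y + 1) = 0 := by
    rcases hx' with rfl | rfl <;> linear_combination heq
  refine ⟨hx', ?_⟩
  rcases mul_eq_zero.mp hy with h0 | h1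
  · exact Or.inl h0
  · exact Or.inr (by linear_combination h1)

/-- **`#ker φ = 5`** (`= deg U`, Silverman *AEC* III.4.10(c) in characteristic `0`; tree
`IsogenyFormula.degree_toIsogeny`, with `U`, `h` coprime). [cite: SilvermanAEC2009, Thm. III.4.10(c) and Rem. III.4.13.3] -/
theorem natCard_ker_fiveIsogeny : Nat.card fiveIsogeny.toAddMonoidHom.ker = 5 := by
  have h := fiveIsogenyFormula.degree_toIsogeny
    (isCoprime_fiveIsogenyFormula_U_h.map (Polynomial.mapRingHom (algebraMap ℚ (AlgebraicClosure ℚ))))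
  rw [natDegree_fiveIsogenyFormula_U] at h
  exact h

/-- The five candidate kernel points as a finite set of geometric points. [folklore] -/
theorem ker_fiveIsogeny_subset_five :
    ∃ F : Finset (geomPoints curve11A3), F.card ≤ 5 ∧ Tbar ∈ F ∧
      (fiveIsogeny.toAddMonoidHom.ker : Set (geomPoints curve11A3)) ⊆ F := by
  have h00 : (curve11A3.baseChange (AlgebraicClosure ℚ)).toAffine.Nonsingular 0 0 :=
    (nonsingular_geom_curve11A3_iff 0 0).mpr (by norm_num)
  have h01 : (curve11A3.baseChange (AlgebraicClosure ℚ)).toAffine.Nonsingular 0 (-1) :=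
    (nonsingular_geom_curve11A3_iff 0 (-1)).mpr (by norm_num)
  have h10 : (curve11A3.baseChange (AlgebraicClosure ℚ)).toAffine.Nonsingular 1 0 :=
    (nonsingular_geom_curve11A3_iff 1 0).mpr (by norm_num)
  have h11 : (curve11A3.baseChange (AlgebraicClosure ℚ)).toAffine.Nonsingular 1 (-1) :=
    (nonsingular_geom_curve11A3_iff 1 (-1)).mpr (by norm_num)
  let P00 : geomPoints curve11A3 := Affine.Point.some 0 0 h00
  let P01 : geomPoints curve11A3 := Affine.Point.some 0 (-1) h01
  let P10 : geomPoints curve11A3 := Affine.Point.some 1 0 h10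
  let P11 : geomPoints curve11A3 := Affine.Point.some 1 (-1) h11
  refine ⟨{0, P00, P01, P10, P11}, ?_, Finset.mem_insert_of_mem (Finset.mem_insert_self _ _), ?_⟩
  · exact (Finset.card_insert_le _ _).trans (Nat.succ_le_succ ((Finset.card_insert_le _ _).trans
      (Nat.succ_le_succ ((Finset.card_insert_le _ _).trans (Nat.succ_le_succ
        ((Finset.card_insert_le _ _).trans (Nat.succ_le_succ (Finset.card_singleton _).le)))))))
  · intro P hP
    have hP0 : fiveIsogeny P = 0 := hP
    rw [Finset.mem_coe]
    simp only [Finset.mem_insert, Finset.mem_singleton]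
    rcases mem_ker_fiveIsogeny_imp hP0 with rfl | ⟨x, y, h, rfl, hx, hy⟩
    · exact Or.inl rfl
    · rcases hx with rfl | rfl <;> rcases hy with rfl | rfl
      · exact Or.inr (Or.inl rfl)
      · exact Or.inr (Or.inr (Or.inl rfl))
      · exact Or.inr (Or.inr (Or.inr (Or.inl rfl)))
      · exact Or.inr (Or.inr (Or.inr (Or.inr rfl)))

/-- **`T̄ ∈ ker φ`**, without any chord–tangent computation: `ker φ` has `5` elements and lies
in a five-element set containing `T̄`, so it is that set. [folklore] -/
theorem Tbar_mem_ker : Tbar ∈ fiveIsogeny.toAddMonoidHom.ker := by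
  by_contra hT
  obtain ⟨F, hF5, hTF, hsub⟩ := ker_fiveIsogeny_subset_five
  have hsub' : (fiveIsogeny.toAddMonoidHom.ker : Set (geomPoints curve11A3)) ⊆ ↑(F.erase Tbar) := by
    intro P hP
    rw [Finset.coe_erase]
    exact ⟨hsub hP, fun h => hT (h ▸ hP)⟩
  have h1 : (fiveIsogeny.toAddMonoidHom.ker : Set (geomPoints curve11A3)).ncard ≤ 4 := by
    calc (fiveIsogeny.toAddMonoidHom.ker : Set (geomPoints curve11A3)).ncard
        ≤ (↑(F.erase Tbar) : Set _).ncard := Set.ncard_le_ncard hsub' (Finset.finite_toSet _)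
      _ = (F.erase Tbar).card := Set.ncard_coe_finset _
      _ ≤ 4 := by rw [Finset.card_erase_of_mem hTF]; omega
  have h2 := natCard_ker_fiveIsogeny
  rw [← SetLike.coe_sort_coe, Nat.card_coe_set_eq] at h2
  omega

/-- **`ker φ = ⟨T̄⟩`** (Mazur's cuspidal group `C ≅ ℤ/5` of `X₁(11) → X₀(11)` realised on
`11A3`): `⟨T̄⟩ ≤ ker φ`, and `#⟨T̄⟩ = addOrderOf T̄` divides `#ker φ = 5` with `T̄ ≠ O`.
[cite: Mazur1977, Ch. III §3 Thm. (3.1) (the cuspidal subgroup); Velu1971, example X₀(11)] -/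
theorem ker_fiveIsogeny : fiveIsogeny.toAddMonoidHom.ker = AddSubgroup.zmultiples Tbar := by
  haveI : Finite fiveIsogeny.toAddMonoidHom.ker := fiveIsogeny.finite_ker'
  have hle : AddSubgroup.zmultiples Tbar ≤ fiveIsogeny.toAddMonoidHom.ker :=
    AddSubgroup.zmultiples_le.mpr Tbar_mem_ker
  -- `addOrderOf T̄ ∣ 5` and `T̄ ≠ 0`, so `#⟨T̄⟩ = 5`
  have hdvd : addOrderOf Tbar ∣ 5 := by
    have h := addOrderOf_dvd_natCard (⟨Tbar, Tbar_mem_ker⟩ : fiveIsogeny.toAddMonoidHom.ker)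
    rw [natCard_ker_fiveIsogeny, AddSubgroup.addOrderOf_mk] at h
    exact h
  have hord : addOrderOf Tbar = 5 := by
    rcases (Nat.dvd_prime Nat.prime_five).mp hdvd with h1 | h5
    · exact absurd (AddMonoid.addOrderOf_eq_one_iff.mp h1) Tbar_ne_zero
    · exact h5
  refine (AddSubgroup.eq_of_le_of_card_ge hle ?_).symm
  rw [natCard_ker_fiveIsogeny, Nat.card_zmultiples, hord]

/-- **`T̄` has order `5`.** [cite: CremonaAlgorithms1997, Table 1, N = 11, curve A3 (|T| = 5)] -/
theorem addOrderOf_Tbar : addOrderOf Tbar = 5 := by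
  haveI : Finite fiveIsogeny.toAddMonoidHom.ker := fiveIsogeny.finite_ker'
  have h := natCard_ker_fiveIsogeny
  rwa [ker_fiveIsogeny, Nat.card_zmultiples] at h

/-- **`T = (0,0)` has order `5` in `11A3(ℚ)`.** [cite: CremonaAlgorithms1997, Table 1, N = 11, curve A3] -/
theorem addOrderOf_T [DecidableEq ℚ] : addOrderOf T = 5 := by
  have h1 : addOrderOf (Affine.Point.map (W' := curve11A3.toAffine) (S := ℚ)
      (Algebra.ofId ℚ (AlgebraicClosure ℚ)) T) = addOrderOf T :=
    addOrderOf_injective _ (Affine.Point.map_injective (W' := curve11A3.toAffine)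
      (f := Algebra.ofId ℚ (AlgebraicClosure ℚ))) T
  have h2 : Affine.Point.map (W' := curve11A3.toAffine) (S := ℚ)
      (Algebra.ofId ℚ (AlgebraicClosure ℚ)) T = Tbar := toGeomPoints_T
  rw [h2] at h1
  exact h1.symm.trans addOrderOf_Tbar

/-- `5 T̄ = O`. [folklore] -/
theorem five_nsmul_Tbar : (5 : ℕ) • Tbar = 0 := by
  rw [← addOrderOf_Tbar]; exact addOrderOf_nsmul_eq_zero Tbar

/-- **`φ` is onto `11A1(ℚ̄)`** (Silverman, *AEC*, Thm. II.2.3; tree `Isogeny.surjective`).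
[cite: SilvermanAEC2009, Thm. II.2.3] -/
theorem fiveIsogeny_surjective : Function.Surjective fiveIsogeny :=
  fiveIsogeny.surjective

/-! ### Explicit evaluation of the formula over `ℚ̄` and the node congruence at `11` -/

/-- `U(x)` over `ℚ̄`. [cite: Velu1971, formulae] -/
theorem eval_geom_U (x : AlgebraicClosure ℚ) :
    fiveIsogenyFormula.geom.U.eval x = x ^ 5 - 2 * x ^ 4 + 3 * x ^ 3 - 2 * x + 1 := by
  show (fiveIsogenyFormula.U.map (algebraMap ℚ (AlgebraicClosure ℚ))).eval x = _
  rw [fiveIsogenyFormula_U]; simp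

/-- `S(x)` over `ℚ̄`. [cite: Velu1971, formulae] -/
theorem eval_geom_S (x : AlgebraicClosure ℚ) :
    fiveIsogenyFormula.geom.S.eval x =
      x ^ 6 - 3 * x ^ 5 + x ^ 4 - 3 * x ^ 3 + 6 * x ^ 2 - 6 * x + 2 := by
  show (fiveIsogenyFormula.S.map (algebraMap ℚ (AlgebraicClosure ℚ))).eval x = _
  rw [fiveIsogenyFormula_S]; simp

/-- `T(x)` over `ℚ̄`. [cite: Velu1971, formulae] -/
theorem eval_geom_T (x : AlgebraicClosure ℚ) :
    fiveIsogenyFormula.geom.T.eval x = -x ^ 4 - x ^ 3 + 3 * x ^ 2 - 3 * x + 1 := by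
  show (fiveIsogenyFormula.T.map (algebraMap ℚ (AlgebraicClosure ℚ))).eval x = _
  rw [fiveIsogenyFormula_T]; simp

/-- The `x`-coordinate of `φ(x, y)`: `U(x)/h(x)²`. [cite: Velu1971, formulae] -/
theorem geom_valX (x : AlgebraicClosure ℚ) : fiveIsogenyFormula.geom.valX x =
    (x ^ 5 - 2 * x ^ 4 + 3 * x ^ 3 - 2 * x + 1) / (x ^ 2 - x) ^ 2 := by
  rw [IsogenyFormula.valX, eval_geom_U, eval_geom_h]

/-- The `y`-coordinate of `φ(x, y)`: `(S(x) y + T(x))/h(x)³`. [cite: Velu1971, formulae] -/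
theorem geom_valY (x y : AlgebraicClosure ℚ) : fiveIsogenyFormula.geom.valY x y =
    ((x ^ 6 - 3 * x ^ 5 + x ^ 4 - 3 * x ^ 3 + 6 * x ^ 2 - 6 * x + 2) * y +
      (-x ^ 4 - x ^ 3 + 3 * x ^ 2 - 3 * x + 1)) / (x ^ 2 - x) ^ 3 := by
  rw [IsogenyFormula.valY, eval_geom_S, eval_geom_T, eval_geom_h]

/-- **Node congruence, `x`-coordinate**: `U - 5h² ∈ (x - 8, 11)` — explicitly
`U(x) - 5h(x)² = (x - 8)(x⁴ + x³ + 21x² + 163x + 1302) + 11·947` in any commutative ring. With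
`h - 1 = (x - 8)(x + 7) + 11·5` (`node_congr_h`) this says that the formula maps a point
congruent to the node `(8, 5)` of `11A3 mod 11` to a point with `x ≡ 5`, the abscissa of the
node `(5, 5)` of `11A1 mod 11` (the isogeny of Néron models maps the singular point of the special
fibre of `11A3` at `11` (type `I₁`) to that of `11A1` (type `I₅`)). [folklore] -/
theorem node_congr_X {R : Type*} [CommRing R] (x : R) :
    (x ^ 5 - 2 * x ^ 4 + 3 * x ^ 3 - 2 * x + 1) - 5 * (x ^ 2 - x) ^ 2 =
      (x - 8) * (x ^ 4 + x ^ 3 + 21 * x ^ 2 + 163 * x + 1302) + 11 * 947 := by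
  ring

/-- **Node congruence, `y`-coordinate**: `S(x)y + T(x) - 5h(x)³ = S(x)(y - 5) + 11·T(x)` (note
`5S - 5h³ = 10T`, i.e. `S = 2T + h³`, the first identity of the formula), so `y ≡ 5` is mapped to
`y' ≡ 5` modulo `(y - 5, 11)`. [folklore] -/
theorem node_congr_Y {R : Type*} [CommRing R] (x y : R) :
    (x ^ 6 - 3 * x ^ 5 + x ^ 4 - 3 * x ^ 3 + 6 * x ^ 2 - 6 * x + 2) * y +
        (-x ^ 4 - x ^ 3 + 3 * x ^ 2 - 3 * x + 1) - 5 * (x ^ 2 - x) ^ 3 =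
      (x ^ 6 - 3 * x ^ 5 + x ^ 4 - 3 * x ^ 3 + 6 * x ^ 2 - 6 * x + 2) * (y - 5) +
        11 * (-x ^ 4 - x ^ 3 + 3 * x ^ 2 - 3 * x + 1) := by
  ring

/-- **Node congruence, denominator**: `h(x) - 1 = (x - 8)(x + 7) + 11·5`, so `h(x)` is a unit at
any prime above `11` when `x ≡ 8`. [folklore] -/
theorem node_congr_h {R : Type*} [CommRing R] (x : R) :
    (x ^ 2 - x) - 1 = (x - 8) * (x + 7) + 11 * 5 := by
  ring

/-! ### The rational `5`-torsion point `T' = (5, 5)` of `11A1` -/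

/-- `T' = (5, 5) ∈ 11A1(ℚ)` (a generator of `11A1(ℚ) = ℤ/5`; it reduces to the node `(5,5)` of
`11A1 mod 11`). [cite: CremonaAlgorithms1997, Table 1, N = 11, curve A1 (|T| = 5)] -/
def T' : curve11A1.toAffine.Point :=
  Affine.Point.some 5 5 ((Affine.nonsingular_iff' _ _).mpr
    ⟨(Affine.equation_iff _ _).mpr (by norm_num [curve11A1]), Or.inr (by norm_num [curve11A1])⟩)

/-- `T' + T' = (16, -61)` (tangent slope `5` at `(5,5)`); polymorphic in the `DecidableEq ℚ`
instance behind Mathlib's group law. [cite: CremonaAlgorithms1997, Table 1, N = 11, curve A1] -/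
theorem T'_add_T' [DecidableEq ℚ] (h : curve11A1.toAffine.Nonsingular 16 (-61)) :
    T' + T' = Affine.Point.some 16 (-61) h := by
  have hy : (5 : ℚ) ≠ curve11A1.toAffine.negY 5 5 := by norm_num [Affine.negY, curve11A1]
  unfold T'
  rw [Affine.Point.add_self_of_Y_ne hy]
  congr 1
  · rw [Affine.slope_of_Y_ne rfl hy]
    norm_num [Affine.addX, Affine.negY, curve11A1]
  · rw [Affine.slope_of_Y_ne rfl hy]
    norm_num [Affine.addY, Affine.negAddY, Affine.addX, Affine.negY, curve11A1]

/-- `(16, -61) + (16, -61) = (5, -6) = -T'` (tangent slope `-6` at `(16,-61)`).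
[cite: CremonaAlgorithms1997, Table 1, N = 11, curve A1] -/
theorem P16_add_P16 [DecidableEq ℚ] (h : curve11A1.toAffine.Nonsingular 16 (-61)) :
    Affine.Point.some 16 (-61) h + Affine.Point.some 16 (-61) h = -T' := by
  have hy : (-61 : ℚ) ≠ curve11A1.toAffine.negY 16 (-61) := by norm_num [Affine.negY, curve11A1]
  unfold T'
  rw [Affine.Point.add_self_of_Y_ne hy, Affine.Point.neg_some]
  congr 1
  · rw [Affine.slope_of_Y_ne rfl hy]
    norm_num [Affine.addX, Affine.negY, curve11A1]
  · rw [Affine.slope_of_Y_ne rfl hy]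
    norm_num [Affine.addY, Affine.negAddY, Affine.addX, Affine.negY, curve11A1]

/-- **`5 T' = O`.** [cite: CremonaAlgorithms1997, Table 1, N = 11, curve A1 (|T| = 5)] -/
theorem five_nsmul_T' [DecidableEq ℚ] : (5 : ℕ) • T' = 0 := by
  have h16 : curve11A1.toAffine.Nonsingular 16 (-61) := (Affine.nonsingular_iff' _ _).mpr
    ⟨(Affine.equation_iff _ _).mpr (by norm_num [curve11A1]), Or.inr (by norm_num [curve11A1])⟩
  rw [show (5 : ℕ) = 2 + 2 + 1 from rfl, add_nsmul, add_nsmul, two_nsmul, one_nsmul,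
    T'_add_T' h16, P16_add_P16 h16, neg_add_cancel]

/-- `T' ≠ O`. [folklore] -/
theorem T'_ne_zero : T' ≠ 0 := Affine.Point.some_ne_zero _

/-- The geometric point `T̄' ∈ 11A1(ℚ̄)` of `T'` (the image of `T'` under Mathlib's
`Affine.Point.map` along `ℚ → ℚ̄`; this is the tree's `toGeomPoints curve11A1 T'`, spelled with
the `DecidableEq ℚ` instance of this file — the two agree definitionally on points). [folklore] -/
def T'bar : geomPoints curve11A1 :=
  Affine.Point.map (W' := curve11A1.toAffine) (S := ℚ) (Algebra.ofId ℚ (AlgebraicClosure ℚ)) T'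

/-- `T̄'` is the tree's `toGeomPoints curve11A1 T'`. [folklore] -/
theorem toGeomPoints_T' : toGeomPoints curve11A1 T' = T'bar := rfl

/-- `5 T̄' = O`. [folklore] -/
theorem five_nsmul_T'bar : (5 : ℕ) • T'bar = 0 := by
  have h := map_nsmul (Affine.Point.map (W' := curve11A1.toAffine) (S := ℚ)
    (Algebra.ofId ℚ (AlgebraicClosure ℚ))) 5 T'
  rw [five_nsmul_T', map_zero] at h
  exact h.symm

/-- `T̄' ≠ O`. [folklore] -/
theorem T'bar_ne_zero : T'bar ≠ 0 := fun h =>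
  T'_ne_zero (Affine.Point.map_injective (W' := curve11A1.toAffine)
    (f := Algebra.ofId ℚ (AlgebraicClosure ℚ)) (h.trans (map_zero _).symm))

/-- `T̄'` is `Γ_ℚ`-fixed. [folklore] -/
theorem smul_T'bar (σ : Field.absoluteGaloisGroup ℚ) : σ • T'bar = T'bar :=
  smul_toGeomPoints curve11A1 σ T'

/-! ### The mod-`5` cyclotomic character of `Γ_ℚ` is non-trivial -/

/-- **`χ̄₅ ≠ 1` on `Γ_ℚ`**: a primitive fifth root of unity `ζ ∈ ℚ̄` is moved by some `σ ∈ Γ_ℚ`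
(otherwise `ζ ∈ ℚ̄^{Γ_ℚ} = ℚ`, and a rational `ζ` with `ζ⁵ = 1` is `1`), and `σ ζ = ζ^{χ̄₅(σ)}`.
[folklore] -/
theorem exists_modPCyclotomicCharacterZMod_five_ne_one :
    ∃ σ : Field.absoluteGaloisGroup ℚ,
      GaloisRepresentations.modPCyclotomicCharacterZMod ℚ 5 σ ≠ 1 := by
  by_contra hall
  push Not at hall
  -- a primitive fifth root of unity in `ℚ̄`
  obtain ⟨ζ, hζ⟩ := HasEnoughRootsOfUnity.prim (M := AlgebraicClosure ℚ) (n := 5)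
  have hζ5 : ζ ^ 5 = 1 := hζ.pow_eq_one
  -- it is fixed by `Γ_ℚ`
  have hfix : ∀ f : AlgebraicClosure ℚ ≃ₐ[ℚ] AlgebraicClosure ℚ, f ζ = ζ := by
    intro f
    have h := GaloisRepresentations.modPCyclotomicCharacterZMod_spec ℚ 5 f ζ hζ5
    rw [hall f, Units.val_one, ZMod.val_one, pow_one] at h
    exact h
  haveI : Algebra.IsAlgebraic ℚ (AlgebraicClosure ℚ) := AlgebraicClosure.isAlgebraic ℚ
  haveI : IsGalois ℚ (AlgebraicClosure ℚ) :=
    @IsAlgClosure.isGalois ℚ (AlgebraicClosure ℚ) _ _ (AlgebraicClosure.instAlgebra ℚ) inferInstance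
      inferInstance
  obtain ⟨q, hq⟩ := (InfiniteGalois.mem_range_algebraMap_iff_fixed ζ).mpr hfix
  -- so `ζ = q ∈ ℚ` with `q⁵ = 1`, hence `q = 1`
  have hq5 : q ^ 5 = 1 := by
    apply (algebraMap ℚ (AlgebraicClosure ℚ)).injective
    rw [map_pow, hq, hζ5, map_one]
  have hq1 : q = 1 := by
    rcases le_or_gt 0 q with h0 | h0
    · exact (pow_eq_one_iff_of_nonneg h0 (by norm_num)).mp hq5
    · exact absurd hq5 (ne_of_lt (lt_of_lt_of_le ((Odd.pow_neg (by decide) h0)) zero_le_one))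
  rw [hq1, map_one] at hq
  exact hζ.ne_one (by norm_num) hq.symm

/-! ### The `Γ_ℚ`-stable `⟨T⟩`-coset above `T'` -/

/-- **The fibre of `φ` over `T'`.** There is `Q₀ ∈ 11A3(ℚ̄)` with `φ Q₀ = T̄'`; its coset
`Q₀ + ⟨T̄⟩ = φ⁻¹(T̄')` is `Γ_ℚ`-stable (`σ Q₀ - Q₀ ∈ ker φ = ⟨T̄⟩`), `5 Q₀ ∈ ⟨T̄⟩`
(`φ(5Q₀) = 5T̄' = O`), and **`5 Q₀ ≠ O`**: if `5Q₀ = O` then, `Q₀ + ⟨T̄⟩` being stable, Mazur's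
(5.4) `σ Q₀ - χ̄₅(σ) Q₀ ∈ ⟨T̄⟩` (tree `smul_sub_cyclotomic_smul_mem_zmultiples`, from
`det ρ̄_{E,5} = χ̄₅` and the proved Weil pairing) gives `(χ̄₅(σ) - 1) Q₀ ∈ ⟨T̄⟩`, and choosing
`σ` with `χ̄₅(σ) ≠ 1` forces `Q₀ ∈ ⟨T̄⟩ = ker φ`, `T̄' = O`, absurd. (So `Q₀` has order `25`: in
Mazur's terms the rational point `T'` of `J₀(11)` is cuspidal-dual, not in the Shimura subgroup
`φ(E[5]) ≅ μ₅`.) [cite: Mazur1977, Ch. III §5 p. 157 ((5.4)) and Ch. II §11; SilvermanAEC2009, Thm. II.2.3] -/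
theorem exists_stableCoset_over_T' :
    ∃ Q₀ : geomPoints curve11A3, fiveIsogeny Q₀ = T'bar ∧
      (∀ σ : Field.absoluteGaloisGroup ℚ, σ • Q₀ - Q₀ ∈ AddSubgroup.zmultiples Tbar) ∧
      (5 : ℕ) • Q₀ ∈ AddSubgroup.zmultiples Tbar ∧ (5 : ℕ) • Q₀ ≠ 0 := by
  obtain ⟨Q₀, hQ₀⟩ := fiveIsogeny_surjective T'bar
  have hstab : ∀ σ : Field.absoluteGaloisGroup ℚ, σ • Q₀ - Q₀ ∈ AddSubgroup.zmultiples Tbar := by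
    intro σ
    rw [← ker_fiveIsogeny, AddMonoidHom.mem_ker, map_sub]
    show fiveIsogeny (σ • Q₀) - fiveIsogeny Q₀ = 0
    rw [fiveIsogeny.map_smul, hQ₀, smul_T'bar, sub_self]
  have h5 : (5 : ℕ) • Q₀ ∈ AddSubgroup.zmultiples Tbar := by
    rw [← ker_fiveIsogeny, AddMonoidHom.mem_ker, map_nsmul]
    show (5 : ℕ) • fiveIsogeny Q₀ = 0
    rw [hQ₀, five_nsmul_T'bar]
  refine ⟨Q₀, hQ₀, hstab, h5, fun h50 => ?_⟩
  -- `Q₀ ∈ E[5]`; Mazur's (5.4) in the frame through `T̄`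
  have hQmem : Q₀ ∈ geomTorsion curve11A3 ((5 : ℕ) : ℤ) := by
    rw [mem_torsionBy_iff, natCast_zsmul]; exact h50
  have hTmem : Tbar ∈ geomTorsion curve11A3 ((5 : ℕ) : ℤ) := by
    rw [mem_torsionBy_iff, natCast_zsmul]; exact five_nsmul_Tbar
  set Tt : geomTorsion curve11A3 ((5 : ℕ) : ℤ) := ⟨Tbar, hTmem⟩ with hTt
  set St : geomTorsion curve11A3 ((5 : ℕ) : ℤ) := ⟨Q₀, hQmem⟩ with hSt
  have hTt0 : Tt ≠ 0 := fun h => Tbar_ne_zero (congrArg Subtype.val h)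
  have hTtfix : ∀ σ : Field.absoluteGaloisGroup ℚ, σ • Tt = Tt := fun σ =>
    Subtype.ext (smul_Tbar σ)
  obtain ⟨σ, hσ⟩ := exists_modPCyclotomicCharacterZMod_five_ne_one
  have hmaz := smul_sub_cyclotomic_smul_mem_zmultiples curve11A3 5 hTt0 hTtfix σ St
  set d : ℕ := ((GaloisRepresentations.modPCyclotomicCharacterZMod ℚ 5 σ : (ZMod 5)ˣ) :
    ZMod 5).val with hd
  -- transport to `geomPoints`: `σ Q₀ - d Q₀ ∈ ⟨T̄⟩`
  have hmaz' : σ • Q₀ - d • Q₀ ∈ AddSubgroup.zmultiples Tbar := by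
    obtain ⟨k, hk⟩ := AddSubgroup.mem_zmultiples_iff.mp hmaz
    refine AddSubgroup.mem_zmultiples_iff.mpr ⟨k, ?_⟩
    have := congrArg Subtype.val hk
    simpa [hTt, hSt] using this
  -- hence `(d - 1) Q₀ ∈ ⟨T̄⟩`… as `d Q₀ - Q₀`
  have hdiff : d • Q₀ - Q₀ ∈ AddSubgroup.zmultiples Tbar := by
    have := (AddSubgroup.zmultiples Tbar).sub_mem (hstab σ) hmaz'
    rwa [show σ • Q₀ - Q₀ - (σ • Q₀ - d • Q₀) = d • Q₀ - Q₀ by abel] at this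
  -- `d ∈ {2, 3, 4}`
  have hd5 : d < 5 := ZMod.val_lt _
  have hd0 : d ≠ 0 := by
    intro h0
    have : ((GaloisRepresentations.modPCyclotomicCharacterZMod ℚ 5 σ : (ZMod 5)ˣ) : ZMod 5) = 0 :=
      (ZMod.val_eq_zero _).mp h0
    exact (GaloisRepresentations.modPCyclotomicCharacterZMod ℚ 5 σ).ne_zero this
  have hd1 : d ≠ 1 := by
    intro h1
    apply hσ
    apply Units.ext
    rw [Units.val_one, ← ZMod.natCast_zmod_val
      ((GaloisRepresentations.modPCyclotomicCharacterZMod ℚ 5 σ : (ZMod 5)ˣ) : ZMod 5)]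
    show ((d : ℕ) : ZMod 5) = 1
    rw [h1, Nat.cast_one]
  -- `(d - 1) Q₀ ∈ ⟨T̄⟩` with `d - 1` invertible modulo `5`, and `5 Q₀ = O`: so `Q₀ ∈ ⟨T̄⟩`
  have hdiff' : ((d : ℤ) - 1) • Q₀ ∈ AddSubgroup.zmultiples Tbar := by
    rwa [sub_zsmul, one_zsmul, natCast_zsmul]
  have h50' : (5 : ℤ) • Q₀ = 0 := by
    rw [show (5 : ℤ) = ((5 : ℕ) : ℤ) from rfl, natCast_zsmul]; exact h50
  obtain ⟨m, k, hmk⟩ : ∃ m k : ℤ, m * ((d : ℤ) - 1) = 1 + 5 * k := by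
    interval_cases d
    · exact absurd rfl hd0
    · exact absurd rfl hd1
    · exact ⟨1, 0, by norm_num⟩
    · exact ⟨3, 1, by norm_num⟩
    · exact ⟨2, 1, by norm_num⟩
  have hQT : Q₀ ∈ AddSubgroup.zmultiples Tbar := by
    have key : m • (((d : ℤ) - 1) • Q₀) = Q₀ := by
      rw [smul_smul, hmk, add_smul, one_smul, mul_comm, ← smul_smul, h50', smul_zero, add_zero]
    rw [← key]
    exact (AddSubgroup.zmultiples Tbar).zsmul_mem hdiff' m
  -- so `Q₀ ∈ ker φ` and `T̄' = O`
  rw [← ker_fiveIsogeny, AddMonoidHom.mem_ker] at hQT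
  exact T'bar_ne_zero (hQ₀ ▸ hQT)

end Literature.NumberTheory.EllipticCurves.X1Eleven

end
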